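/-
Copyright (c) 2026. All rights reserved.
Released under Apache 2.0 license as described in the file LICENSE.
Authors: abc-iut cell, fact-proving seat abc-iut-f-074 (block F, tranche 74; combinatorics of `Γ⃗_{𝒟*}`
for the exact criterion behind [AbsTopIII] Cor 3.7 (iv)).
-/
import Literature.AnabelianGeometry.AbsoluteAnabelian.AbsTopIII.MonoAnabelianComparisonShapes
import Mathlib.Combinatorics.Quiver.Path

/-!
# [AbsTopIII] Cor 3.7: combinatorics of the oriented graph `Γ⃗_{𝒟*}` — rows along paths, the λ-type
# of a path, the flip `λ^× ↦ λ^{×pf}`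

S. Mochizuki, *Topics in absolute anabelian geometry III* [MochizukiAbsTopIII2015] (kurims manuscript
`paper:url-5493eb38cbb7`), Cor 3.7 (ii)–(iv) pp. 87–88: the oriented graph `Γ⃗_{𝒟*}` (abc-iut-L4-t9's
`Cor37Vertex` / `Cor37Edge`, `MonoAnabelianComparisonShapes.lean`).  Bookkeeping companion (no notion
of the paper is asserted): rows do not decrease along edges and paths (`Cor37Edge.row_le`,
`Cor37Vertex.row_le_of_path`); the λ-TYPE of an edge / a path (`Cor37Edge.lamType`, `starLamType`:
`none` = no `λ`-edge, `some true` = through `λ^×`, `some false` = through `λ^{×pf}`; composition law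
`starLamType_comp`; paths into rows ≤ 2 or out of rows ≥ 3 have none); the FLIP `λ^× ↦ λ^{×pf}` of an
edge / a path (`Cor37Edge.flip`, `starFlip`; `starFlip_comp`, `starLamType_flip`, `starFlip_eq_self`).
Used by the coherent system of `ι_×`-cells on the shadow of `𝒟*` (`BiAnabelianStarShadowCells.lean`).
Nothing here bears on [IUTchIII] Cor. 3.12.
-/

set_option autoImplicit false

namespace Literature.AnabelianGeometry.AbsoluteAnabelian

open Quiver

universe w

namespace AbsTopIII

/-! ## Combinatorics of `Γ⃗_{𝒟*}` -/

namespace Cor37Edge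

/-- Rows do not decrease along an edge of `Γ⃗_{𝒟*}`. [cite: MochizukiAbsTopIII2015, Cor 3.7 (ii) p.87] -/
theorem row_le : ∀ {a b : Cor37Vertex} (_ : Cor37Edge.{w} a b), a.row ≤ b.row
  | _, _, .log _ _ _ => Nat.le_refl _
  | _, _, .pr _ => by simp [Cor37Vertex.row]
  | _, _, .lamTimes => by simp [Cor37Vertex.row]
  | _, _, .lamTimesPf => by simp [Cor37Vertex.row]
  | _, _, .toGal => by simp [Cor37Vertex.row]
  | _, _, .proj _ => Nat.le_refl _
  | _, _, .diag _ => Nat.le_refl _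
  | _, _, .diagBox => by simp [Cor37Vertex.row]

/-- The λ-type of an edge: `λ^×` ↦ `some true`, `λ^{×pf}` ↦ `some false`, every other edge ↦ `none`.
[cite: MochizukiAbsTopIII2015, Cor 3.7 (iii) p.88] -/
def lamType : ∀ {a b : Cor37Vertex}, Cor37Edge.{w} a b → Option Bool
  | _, _, .log _ _ _ => none
  | _, _, .pr _ => none
  | _, _, .lamTimes => some true
  | _, _, .lamTimesPf => some false
  | _, _, .toGal => none
  | _, _, .proj _ => none
  | _, _, .diag _ => none
  | _, _, .diagBox => none

/-- The flip of an edge: `λ^× ↦ λ^{×pf}`, identity on every other edge.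
[cite: MochizukiAbsTopIII2015, Cor 3.7 (iii) p.88] -/
def flip : ∀ {a b : Cor37Vertex}, Cor37Edge.{w} a b → Cor37Edge.{w} a b
  | _, _, .log m n h => .log m n h
  | _, _, .pr n => .pr n
  | _, _, .lamTimes => .lamTimesPf
  | _, _, .lamTimesPf => .lamTimesPf
  | _, _, .toGal => .toGal
  | _, _, .proj n => .proj n
  | _, _, .diag n => .diag n
  | _, _, .diagBox => .diagBox

/-- The flip changes the λ-type to `λ^{×pf}`. [cite: MochizukiAbsTopIII2015, Cor 3.7 (iii) p.88] -/
theorem lamType_flip {a b : Cor37Vertex} (e : Cor37Edge.{w} a b) :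
    (flip e).lamType = e.lamType.map (fun _ => false) := by
  cases e <;> rfl

/-- An edge other than `λ^×` is its own flip. [cite: MochizukiAbsTopIII2015, Cor 3.7 (iii) p.88] -/
theorem flip_eq_self {a b : Cor37Vertex} (e : Cor37Edge.{w} a b) (h : e.lamType ≠ some true) :
    flip e = e := by
  cases e <;> first | rfl | exact absurd rfl h

/-- An edge into a vertex of row `≤ 2` has no λ-type. [cite: MochizukiAbsTopIII2015, Cor 3.7 (ii) p.87] -/
theorem lamType_eq_none_of_row {a b : Cor37Vertex} (e : Cor37Edge.{w} a b) (hb : b.row ≤ 2) :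
    e.lamType = none := by
  cases e <;> first | rfl | (simp [Cor37Vertex.row] at hb)

/-- An edge out of a vertex of row `≥ 3` has no λ-type. [cite: MochizukiAbsTopIII2015, Cor 3.7 (ii) p.87] -/
theorem lamType_eq_none_of_source {a b : Cor37Vertex} (e : Cor37Edge.{w} a b) (ha : 3 ≤ a.row) :
    e.lamType = none := by
  cases e <;> first | rfl | (simp [Cor37Vertex.row] at ha)

end Cor37Edge

/-- Paths on `Γ⃗_{𝒟*}` with edges in universe `w` (the universe of abc-iut-L4-t9's `starDiagram`).
[cite: MochizukiAbsTopIII2015, Cor 3.7 (ii) p.87] -/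
abbrev StarPath (a b : Cor37Vertex) : Type w := @Quiver.Path Cor37Vertex Cor37Vertex.instQuiver.{w} a b

namespace Cor37Vertex

/-- Rows do not decrease along a path of `Γ⃗_{𝒟*}`. [cite: MochizukiAbsTopIII2015, Cor 3.7 (ii) p.87] -/
theorem row_le_of_path {a : Cor37Vertex} : ∀ {b : Cor37Vertex} (_ : StarPath.{w} a b), a.row ≤ b.row
  | _, .nil => Nat.le_refl _
  | _, .cons p e => Nat.le_trans (row_le_of_path p) (Cor37Edge.row_le e)

end Cor37Vertex

section StarPaths

variable {a : Cor37Vertex}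

/-- The λ-type of a path: the λ-type of its last `λ`-edge (`none` if there is none).
[cite: MochizukiAbsTopIII2015, Cor 3.7 (iii) p.88] -/
def starLamType : ∀ {b : Cor37Vertex}, StarPath.{w} a b → Option Bool
  | _, .nil => none
  | _, .cons p e => (Cor37Edge.lamType e).or (starLamType p)

/-- The flip `λ^× ↦ λ^{×pf}` of a path. [cite: MochizukiAbsTopIII2015, Cor 3.7 (iii) p.88] -/
def starFlip : ∀ {b : Cor37Vertex}, StarPath.{w} a b → StarPath.{w} a b
  | _, .nil => .nil
  | _, .cons p e => .cons (starFlip p) (Cor37Edge.flip e)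

/-- λ-type of a composite path. [cite: MochizukiAbsTopIII2015, Cor 3.7 (iii) p.88] -/
theorem starLamType_comp {b : Cor37Vertex} (r : StarPath.{w} a b) :
    ∀ {c : Cor37Vertex} (p : StarPath.{w} b c),
      starLamType (r.comp p) = (starLamType p).or (starLamType r)
  | _, .nil => by simp [starLamType]
  | _, .cons p e => by
    rw [Path.comp_cons]
    simp only [starLamType, starLamType_comp r p]
    cases Cor37Edge.lamType e <;> rfl

/-- The flip of a composite path. [cite: MochizukiAbsTopIII2015, Cor 3.7 (iii) p.88] -/
theorem starFlip_comp {b : Cor37Vertex} (r : StarPath.{w} a b) :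
    ∀ {c : Cor37Vertex} (p : StarPath.{w} b c), starFlip (r.comp p) = (starFlip r).comp (starFlip p)
  | _, .nil => rfl
  | _, .cons p e => by rw [Path.comp_cons, starFlip, starFlip_comp r p]; rfl

/-- λ-type of a flipped path. [cite: MochizukiAbsTopIII2015, Cor 3.7 (iii) p.88] -/
theorem starLamType_flip : ∀ {b : Cor37Vertex} (p : StarPath.{w} a b),
    starLamType (starFlip p) = (starLamType p).map (fun _ => false)
  | _, .nil => rfl
  | _, .cons p e => by
    simp only [starFlip, starLamType, starLamType_flip p, Cor37Edge.lamType_flip]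
    cases Cor37Edge.lamType e <;> cases starLamType p <;> rfl

/-- A path into a vertex of row `≤ 2` has no λ-type. [cite: MochizukiAbsTopIII2015, Cor 3.7 (ii) p.87] -/
theorem starLamType_eq_none_of_row : ∀ {b : Cor37Vertex} (p : StarPath.{w} a b), b.row ≤ 2 →
    starLamType p = none
  | _, .nil, _ => rfl
  | _, .cons p e, hb => by
    simp only [starLamType, Cor37Edge.lamType_eq_none_of_row e hb, Option.none_or]
    exact starLamType_eq_none_of_row p (Nat.le_trans (Cor37Edge.row_le e) hb)

/-- A path out of a vertex of row `≥ 3` has no λ-type. [cite: MochizukiAbsTopIII2015, Cor 3.7 (ii) p.87] -/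
theorem starLamType_eq_none_of_source (ha : 3 ≤ a.row) : ∀ {b : Cor37Vertex} (p : StarPath.{w} a b),
    starLamType p = none
  | _, .nil => rfl
  | _, .cons p e => by
    simp only [starLamType, starLamType_eq_none_of_source ha p, Option.or_none]
    exact Cor37Edge.lamType_eq_none_of_source e (Nat.le_trans ha (Cor37Vertex.row_le_of_path p))

/-- A path not through `λ^×` is its own flip. [cite: MochizukiAbsTopIII2015, Cor 3.7 (iii) p.88] -/
theorem starFlip_eq_self {b : Cor37Vertex} (p : StarPath.{w} a b) (h : starLamType p ≠ some true) :
    starFlip p = p := by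
  induction p with
  | nil => rfl
  | cons p e ih =>
    have he : Cor37Edge.lamType e ≠ some true := fun he => h (by simp [starLamType, he])
    have hp : starLamType p ≠ some true := by
      intro hp
      cases e
      case lamTimes => exact he rfl
      case lamTimesPf =>
        exact absurd (starLamType_eq_none_of_row p (by simp [Cor37Vertex.row])) (by simp [hp])
      all_goals exact h (by simp [starLamType, Cor37Edge.lamType, hp])
    rw [starFlip, ih hp, Cor37Edge.flip_eq_self e he]

/-- The source of a path of λ-type `λ^×` lies in rows `≤ 2`. [cite: MochizukiAbsTopIII2015, Cor 3.7 (iii) p.88] -/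
theorem row_le_two_of_starLamType {b : Cor37Vertex} (p : StarPath.{w} a b)
    (h : starLamType p = some true) : a.row ≤ 2 := by
  by_contra ha
  rw [starLamType_eq_none_of_source (by omega) p] at h
  cases h

end StarPaths

end AbsTopIII

end Literature.AnabelianGeometry.AbsoluteAnabelian
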